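import Summits.BirchSwinnertonDyer.BirchSwinnertonDyer.Theorems.CongruentShaFreeCutTwoAdicBDPExistsValueUpTo

set_option linter.dupNamespace false -- `Summit.BirchSwinnertonDyer.BirchSwinnertonDyer.Theorems.…` (summit = sub)
set_option autoImplicit false

/-! # Route `CongruentShaFreeCut` (rung S2) — the RESIDUAL side in the folded ♯ currency: the corank-currency
plumbing, crux A (`RankPosOfTwoSelmerCorankOne`, stmt-BirchSwinnertonDyer-19079) and the rung-S2 leaf from
(res) + (LB-exist∧bdp♯)∃ + (LB-wan♯) — NO ∀-tuple quantifier, NO character supply, NO textbook hypothesis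

Cell `bsd-cn100`, prover seat `bsd-cn100-transfer` (g11); sibling of
`CongruentShaFreeCutTwoAdicBDPExistsValueUpTo.lean` (the fold `TwoAdicBDPElementExistsWithValueUpTo` + the
rank-currency plumbing + crux B's census) and the S2 twin of s2b-c3 g7's
`MordellShaFreeCutThreeAdicBDPExistsValueResidual.lean`. Supports, does not close,
stmt-BirchSwinnertonDyer-19079 (the route's RESIDUAL; registered line `heegner-field-bdp-triple-upto` v6cp:
`stub_refereedInputs`, (res) `stub_twoLocNonDegeneracy`, the ♯ triple). THEOREMS ONLY; ports of the landed
♯ corank-currency plumbing `CongruentShaFreeCutBDPTripleUpToCensus.*` (p450735) and of the PT-free census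
`CongruentShaFreeCutCensusPTFree.cruxA_of_res_of_bdpTripleUpTo / cruxA_iff_res_of_bdpTripleUpTo /
leaf_of_res_of_bdpTripleUpTo` (p457436) with the pair {(LB-exist♯), (LB-bdp♯) ∀-tuple} replaced by the ONE
statement (LB-exist∧bdp♯)∃ — the plumbing reads (LB-bdp♯) only at the tuple of (LB-exist♯), so one `obtain`
replaces two.

* §1 `heegnerPoint_not_isOfFinAddOrder_of_corankLinkA_of_bdpExistsValueUpTo` (Link A in corank form +
  (LB-exist∧bdp♯)∃ + (LB-wan♯) ⟹ every Heegner point on `E_n` is non-torsion at a corank-one datum);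
  `rankPos_squarefree_of_corankLinkA_of_bdpExistsValueUpTo` (+ five refereed facts ⟹ rank ≥ 1 on square-free
  `n` with corank one).
* §2 `cruxA_of_res_of_bdpExistsValueUpTo` — **crux A ⟸ (res) at `2` + (LB-exist∧bdp♯)∃ + (LB-wan♯) + five
  refereed facts, NOTHING ELSE** (Link A in corank form = `twoAdicControlOfCorankOne_of_res_ptFree`, PT
  discharged); `cruxA_iff_res_of_bdpExistsValueUpTo` (modulo the two research statements and the facts,
  crux A ⟺ (res)); `leaf_of_res_of_bdpExistsValueUpTo` — **the rung-S2 leaf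
  `rankOne_twoConverse_congruentNumber` ⟸ {(res), (LB-exist∧bdp♯)∃, (LB-wan♯)} + the six refereed facts**:
  research content of the whole BDP road = ONE Selmer-only statement at the additive prime `2` + ONE
  construction-with-value (MEMO-transfer-13 Thm 13.1 + (5.3.1), written) + ONE main-conjecture divisibility.

HONEST FRAMING: CONDITIONAL reductions; nothing here proves (res), (LB-exist∧bdp♯)∃, (LB-wan♯), crux A, the
leaf, the congruent number problem or any case of BSD. PARTITION: none — RANK axis.

References: [Castella2018] Thm. 2.3, 3.4 (shape); [CastellaGrossiLeeSkinner2022] §5.2; [Skinner2020] Thm. B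
(shape); [WZhang2014] Thm. 1.3; [SilvermanAEC2009] IV.6.4, VII.2.2; [GrossZagier1986] Thm. I.6.3. -/

noncomputable section

open scoped Classical

namespace Summit.BirchSwinnertonDyer.BirchSwinnertonDyer.Theorems.CongruentShaFreeCutTwoAdicBDPExistsValueUpTo

open PowerSeries WeierstrassCurve NumberField IsDedekindDomain Field Literature.NumberTheory.EllipticCurves
  Literature.NumberTheory.EllipticCurves.ModularForms Literature.NumberTheory.QuadraticFields
  Literature.NumberTheory.EllipticCurves.Castella2018
open Literature.NumberTheory.GaloisRepresentations Literature.NumberTheory.GaloisCohomology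
open Summit.BirchSwinnertonDyer.BirchSwinnertonDyer.Theses.CongruentShaFreeCut
open Summit.BirchSwinnertonDyer.BirchSwinnertonDyer.Theorems.CongruentShaFreeCutTwoAdicLinks
open Summit.BirchSwinnertonDyer.BirchSwinnertonDyer.Theorems.CongruentShaFreeCutTwoAdicBDPTripleUpTo
  (TwoAdicBDPElementExistsUpTo TwoAdicWanDivisibilityUpTo TwoAdicBDPValueAtOneUpTo)
open Summit.BirchSwinnertonDyer.BirchSwinnertonDyer.Theorems.CongruentShaFreeCutTwoAdicLinksCorank
  (TwoAdicControlOfCorankOne heegnerPointSupply_of_gross)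
open Summit.BirchSwinnertonDyer.BirchSwinnertonDyer.Theorems.CongruentShaFreeCutLocNonDegeneracy
  (twoLocNonDegeneracy_of_cruxA)
open Summit.BirchSwinnertonDyer.BirchSwinnertonDyer.Theorems.CongruentShaFreeCutCensusPTFree
  (twoAdicControlOfCorankOne_of_res_ptFree)

/-! ## §1 The corank-currency plumbing from (LB-exist∧bdp♯)∃ + (LB-wan♯) -/

/-- **Link A in CORANK form + (LB-exist∧bdp♯)∃ + (LB-wan♯) force every Heegner point on `E_n` to be
non-torsion at a corank-one datum** (port of `CongruentShaFreeCutBDPTripleUpToCensus.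
heegnerPoint_not_isOfFinAddOrder_of_corankLinkA_of_bdpTripleUpTo`, p450735, with ONE `obtain` from the folded
statement at the Galois-conjugate reading `P' = τ_* P`; no Kato, no rank hypothesis): `F(0) ≠ 0` (`hAc` at THE
embedding `embAt` of a degree-one `v ∣ 2`) ⟹ `𝓛(0) ≠ 0` ((LB-wan♯) along `toUnr 2`) and
`𝓛(0) = u·c⁻²·(…)²·(log_ω P')²` ⟹ `P` not torsion. CONDITIONAL; credits nothing.
[cite: Castella2018, proof of Thm. 2.3 with Thm. 3.4 (arXiv:1704.06608 pp. 5, 10) (shape)]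
[cite: CastellaGrossiLeeSkinner2022, §5.2 (proof of Thm. 5.2.1)] [cite: SilvermanAEC2009, IV.6.4 and VII.2.2] -/
theorem heegnerPoint_not_isOfFinAddOrder_of_corankLinkA_of_bdpExistsValueUpTo
    (hAc : TwoAdicControlOfCorankOne) (hEV : TwoAdicBDPElementExistsWithValueUpTo)
    (hWan : TwoAdicWanDivisibilityUpTo) :
    ∀ ⦃n : ℕ⦄, Squarefree n → ∀ (K : Type) [Field K] [NumberField K] (N : ℕ) [NeZero N],
      (congruentNumberCurve n).conductorNorm ℤ = N → IsImaginaryQuadratic K →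
        SatisfiesHeegnerHypothesis N K → SatisfiesHeegnerHypothesis 2 K →
          ((congruentNumberCurve n).baseChange K).selmerCorank 2 = 1 →
            ∀ (P : ((congruentNumberCurve n).baseChange K).toAffine.Point),
              IsHeegnerPoint N (congruentNumberCurve n) K P → ¬ IsOfFinAddOrder P := by
  -- adapted from `CongruentShaFreeCutBDPTripleUpToCensus` §1 (p450735)
  intro n hsq K _ _ N _ hN hK hHN hH2 hcK P hP hPtor
  haveI : Fact (Nat.Prime 2) := ⟨Nat.prime_two⟩
  haveI := isElliptic_congruentNumberCurve hsq.ne_zero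
  haveI := isGloballyMinimal_congruentNumberCurve hsq
  have hsplit : ((Ideal.span {(2 : ℤ)}).primesOver (𝓞 K)).ncard = 2 :=
    hH2 2 Nat.prime_two (dvd_refl 2)
  -- (1) the anticyclotomic datum, THE embedding at a degree-one `v ∣ 2`, the partner `v̄`
  obtain ⟨κ, γ, v, hκ, hγ, hv2, he, hf⟩ :=
    Summit.BirchSwinnertonDyer.Rank1Residual.X11b.exists_anticyclotomic_generator_degreeOnePrime 2 K hK hH2
  haveI : Fact (κ.IsTopGenerator γ) := ⟨hγ⟩
  set ι : K →+* ℚ_[2] := Summit.BirchSwinnertonDyer.Rank1Residual.X11b.embAt K 2 v hv2 he hf with hιdef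
  have hv : ∀ x : 𝓞 K, x ∈ v.asIdeal ↔ ‖ι (x : K)‖ < 1 :=
    Summit.BirchSwinnertonDyer.Rank1Residual.X11b.mem_asIdeal_iff_norm_embAt_lt_one v hv2 he hf
  obtain ⟨vbar, hvbar, hne⟩ :=
    Summit.BirchSwinnertonDyer.Rank1Residual.X11b.exists_other_prime hH2 v hv2
  -- (2) Link A (corank form): a generator `F` of `char_Λ 𝔛` with `F(0) ≠ 0`
  obtain ⟨m, hm⟩ := hAc hsq K N hN hK hHN hH2 ι v vbar hv hvbar hne κ hκ γ hcK
  obtain ⟨-, F, hF, hF0, -⟩ := hm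
  have hFmem : F ∈ AcSelmer.XAc.charIdeal ((congruentNumberCurve n).baseChange K) 2 κ vbar ∅ γ := by
    rw [hF]; exact Ideal.mem_span_singleton_self F
  -- (3) the Heegner point data; its Galois conjugate readable at an infinite place
  obtain ⟨Dt, H, ιK, hPK⟩ := hP
  obtain ⟨w₀⟩ := (inferInstance : Nonempty (InfinitePlace K))
  haveI : IsGalois ℚ K := by
    haveI : Algebra.IsQuadraticExtension ℚ K := ⟨hK.1⟩
    infer_instance
  obtain ⟨σ, hσ⟩ := NumberField.ComplexEmbedding.exists_comp_symm_eq_of_comp_eq (k := ℚ)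
    w₀.embedding ιK (by ext x; simp)
  set τ : K →+* K := ((σ.symm : K ≃ₐ[ℚ] K) : K →+* K) with hτdef
  set P' := WeierstrassCurve.Affine.Point.map τ.toRatAlgHom P with hP'def
  have hP' : WeierstrassCurve.Affine.Point.map w₀.embedding.toRatAlgHom P' =
      heegnerPointComplex Dt H := by
    rw [hP'def, WeierstrassCurve.Affine.Point.map_map]
    have hcomp : w₀.embedding.toRatAlgHom.comp τ.toRatAlgHom = ιK.toRatAlgHom := by
      apply AlgHom.ext
      intro x
      have := RingHom.congr_fun hσ x
      simpa [hτdef] using this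
    rw [hcomp]
    exact hPK
  have hP'tor : IsOfFinAddOrder P' := by
    rw [hP'def]; exact AddMonoidHom.isOfFinAddOrder _ hPtor
  -- (4) (LB-exist∧bdp♯)∃ at the conjugate reading: ONE tuple up to `C ≠ 0` WITH its value at `𝟙`
  obtain ⟨ι', hι', ΩK, Ωp, Cst, L, hΩK, hC, hBDP, u, -, hu⟩ :=
    hEV hsq K N Dt H w₀ ι v κ γ P' hN hK hHN hsplit hv2 hκ hP' hv
  -- (5) (LB-wan♯) along `toUnr : ℤ₂ → R₀`: `𝓛(0) ≠ 0`
  obtain ⟨k, hk⟩ := hWan hsq ι' K N Dt v vbar κ γ hN hK hHN hsplit hι' hvbar hne hκ ΩK Ωp Cst L hΩK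
    hC hBDP (Summit.BirchSwinnertonDyer.Rank1Residual.X11b.Halves.toUnr 2)
    (Summit.BirchSwinnertonDyer.Rank1Residual.X11b.Halves.coe_toUnr 2)
  obtain ⟨G, hG⟩ := Ideal.mem_span_singleton'.mp (hk F hFmem)
  have hL0 : PowerSeries.constantCoeff L ≠ 0 := by
    intro h0
    have h1 := congrArg
      (fun S : UnrSeries 2 ↦ ((PowerSeries.constantCoeff S : unrIntegers 2) : ℂ_[2])) hG
    simp only [map_mul, h0, mul_zero, PowerSeries.constantCoeff_C,
      Summit.BirchSwinnertonDyer.Rank1Residual.X11b.CongruenceLimit.constantCoeff_map_apply,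
      Subring.coe_mul, Subring.coe_pow, Subring.coe_zero,
      Summit.BirchSwinnertonDyer.Rank1Residual.X11b.Halves.coe_toUnr] at h1
    have h2 : ((2 : unrIntegers 2) : ℂ_[2]) = (2 : ℂ_[2]) := by norm_cast
    rw [h2] at h1
    have h3 : algebraMap ℚ_[2] ℂ_[2] ((PowerSeries.constantCoeff F : ℤ_[2]) : ℚ_[2]) = 0 := by
      rcases mul_eq_zero.mp h1.symm with h | h
      · exact absurd (pow_eq_zero_iff'.mp h).1 two_ne_zero
      · exact h
    rw [map_eq_zero_iff _ (algebraMap ℚ_[2] ℂ_[2]).injective] at h3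
    exact hF0 (PadicInt.coe_eq_zero.mp h3)
  -- (6) the value at `𝟙` is `u·c⁻²·(…)²·(log_ω P')²`; a torsion `P'` has zero logarithm: contradiction
  have hval := UnrSeries.eq_constantCoeff_of_hasValueAt_zero hu
  have hlog : padicLogOmega (congruentNumberCurve n) 2 ι P' = 0 := by
    unfold padicLogOmega
    rw [AcPConverseLinks.padicLogPoint_formalIndex_smul_eq_zero_of_isOfFinAddOrder
      (congruentNumberCurve n) 2 ι hP'tor, zero_div]
  apply hL0
  rw [hlog, zero_pow two_ne_zero, mul_zero, map_zero, mul_zero] at hval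
  exact_mod_cast hval.symm

/-- **Crux A on square-free `n` from Link A in corank form, (LB-exist∧bdp♯)∃ and (LB-wan♯)** (port of
`CongruentShaFreeCutBDPTripleUpToCensus.rankPos_squarefree_of_corankLinkA_of_bdpTripleUpTo`, p450735; five
refereed facts for the descent field and the Heegner point): descend to the Heegner field
(`CongruentShaFreeCutDescentField.descentField_of_parity_of_hoffsteinLuo_of_kato`), take a Heegner point
(`heegnerPointSupply_of_gross`), apply §1, Mordell–Weil. CONDITIONAL; credits nothing.
[cite: CastellaGrossiLeeSkinner2022, §5.2 (proof of Thm. 5.2.1)] -/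
theorem rankPos_squarefree_of_corankLinkA_of_bdpExistsValueUpTo
    (hpar : ∀ (W : WeierstrassCurve ℚ) [W.IsElliptic] (p : ℕ) [Fact p.Prime], p_parity W p)
    (hmod : ModularForms.exists_isNewformOf) (hHL : HoffsteinLuo1997_exists_twist_L_one_ne_zero)
    (hKato : ∀ (W : WeierstrassCurve ℚ) [W.IsElliptic] (p : ℕ) [Fact p.Prime],
      kato_finite_of_L_one_ne_zero W p)
    (hHP : ∀ (W : WeierstrassCurve ℚ) (K : Type) [Field K] [NumberField K],
      exists_isHeegnerPoint W K)
    (hAc : TwoAdicControlOfCorankOne) (hEV : TwoAdicBDPElementExistsWithValueUpTo)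
    (hWan : TwoAdicWanDivisibilityUpTo) :
    ∀ ⦃n : ℕ⦄, Squarefree n → (congruentNumberCurve n).selmerCorank 2 = 1 →
      1 ≤ (congruentNumberCurve n).mordellWeilRank := by
  intro n hsq hc
  haveI := isElliptic_congruentNumberCurve hsq.ne_zero
  haveI := isGloballyMinimal_congruentNumberCurve hsq
  haveI : NeZero ((congruentNumberCurve n).conductorNorm ℤ) :=
    ⟨((congruentNumberCurve n).conductorNorm_pos_holds).ne'⟩
  obtain ⟨K, _, _, hK, hHN, hH2, hcK, hrk⟩ :=
    CongruentShaFreeCutDescentField.descentField_of_parity_of_hoffsteinLuo_of_kato hpar hmod hHL hKato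
      hsq.ne_zero hc
  obtain ⟨P, hP⟩ :=
    heegnerPointSupply_of_gross hHP hsq K ((congruentNumberCurve n).conductorNorm ℤ) rfl hK hHN
  have hPnt : ¬ IsOfFinAddOrder P :=
    heegnerPoint_not_isOfFinAddOrder_of_corankLinkA_of_bdpExistsValueUpTo hAc hEV hWan hsq K
      ((congruentNumberCurve n).conductorNorm ℤ) rfl hK hHN hH2 hcK P hP
  have hrkK : 1 ≤ ((congruentNumberCurve n).baseChange K).mordellWeilRank :=
    one_le_mordellWeilRank_of_not_isOfFinAddOrder _
      ((congruentNumberCurve n).baseChange K).module_finite_point_holds hPnt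
  rwa [hrk] at hrkK

/-! ## §2 Crux A and the rung-S2 leaf in the folded ♯ currency (PT-free) -/

/-- **CRUX A `RankPosOfTwoSelmerCorankOne` (stmt-BirchSwinnertonDyer-19079) ⟸ (res) at `2` + (LB-exist∧bdp♯)∃ +
(LB-wan♯) + five refereed facts — no textbook hypothesis, no ∀-tuple quantifier.** `hres` = the registered
`stub_twoLocNonDegeneracy` verbatim; Link A in corank form = `twoAdicControlOfCorankOne_of_res_ptFree hres`
(p457436); then `rankPos_squarefree_of_corankLinkA_of_bdpExistsValueUpTo` and the square-free reduction
`rankPosOfTwoSelmerCorankOne_of_squarefree` (p419178). CONDITIONAL; closes nothing.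
[cite: Skinner2020, Thm. B (shape)] [cite: CastellaGrossiLeeSkinner2022, §5.2 (proof of Thm. 5.2.1)] -/
theorem cruxA_of_res_of_bdpExistsValueUpTo
    (hpar : ∀ (W : WeierstrassCurve ℚ) [W.IsElliptic] (p : ℕ) [Fact p.Prime], p_parity W p)
    (hmod : ModularForms.exists_isNewformOf) (hHL : HoffsteinLuo1997_exists_twist_L_one_ne_zero)
    (hKato : ∀ (W : WeierstrassCurve ℚ) [W.IsElliptic] (p : ℕ) [Fact p.Prime],
      kato_finite_of_L_one_ne_zero W p)
    (hHP : ∀ (W : WeierstrassCurve ℚ) (K : Type) [Field K] [NumberField K],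
      exists_isHeegnerPoint W K)
    (hres : ∀ ⦃n : ℕ⦄, Squarefree n → ∀ (K : Type) [Field K] [NumberField K],
      IsImaginaryQuadratic K → SatisfiesHeegnerHypothesis 2 K →
        ((congruentNumberCurve n).baseChange K).selmerCorank 2 = 1 →
      ∀ (w : HeightOneSpectrum (𝓞 K)), ((2 : ℕ) : 𝓞 K) ∈ w.asIdeal →
        Finite ↥(((congruentNumberCurve n).baseChange K).selmerGroupPInfty 2 ⊓
          selmerLocalKerPrimaryTorsion ((congruentNumberCurve n).baseChange K) (w.adicCompletion K) 2))
    (hEV : TwoAdicBDPElementExistsWithValueUpTo) (hWan : TwoAdicWanDivisibilityUpTo) :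
    RankPosOfTwoSelmerCorankOne :=
  CongruentShaFreeCutRankPosSquarefreeReduction.rankPosOfTwoSelmerCorankOne_of_squarefree
    (rankPos_squarefree_of_corankLinkA_of_bdpExistsValueUpTo hpar hmod hHL hKato hHP
      (twoAdicControlOfCorankOne_of_res_ptFree hres) hEV hWan)

/-- **KERNEL CENSUS OF THE RESIDUAL in the folded ♯ currency: modulo (LB-exist∧bdp♯)∃, (LB-wan♯) and five
refereed facts, crux A ⟺ (res) at `2`.** `⟸` is `cruxA_of_res_of_bdpExistsValueUpTo`; `⟹` is the fact-free
`twoLocNonDegeneracy_of_cruxA` (p436277). CONDITIONAL; closes nothing.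
[cite: Skinner2020, Thm. B and §2.2 (shape of (res))] [cite: WZhang2014, Thm. 1.3 and Remark 2 (p. 198)] -/
theorem cruxA_iff_res_of_bdpExistsValueUpTo
    (hpar : ∀ (W : WeierstrassCurve ℚ) [W.IsElliptic] (p : ℕ) [Fact p.Prime], p_parity W p)
    (hmod : ModularForms.exists_isNewformOf) (hHL : HoffsteinLuo1997_exists_twist_L_one_ne_zero)
    (hKato : ∀ (W : WeierstrassCurve ℚ) [W.IsElliptic] (p : ℕ) [Fact p.Prime],
      kato_finite_of_L_one_ne_zero W p)
    (hHP : ∀ (W : WeierstrassCurve ℚ) (K : Type) [Field K] [NumberField K],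
      exists_isHeegnerPoint W K)
    (hEV : TwoAdicBDPElementExistsWithValueUpTo) (hWan : TwoAdicWanDivisibilityUpTo) :
    RankPosOfTwoSelmerCorankOne ↔
      ∀ ⦃n : ℕ⦄, Squarefree n → ∀ (K : Type) [Field K] [NumberField K],
        IsImaginaryQuadratic K → SatisfiesHeegnerHypothesis 2 K →
          ((congruentNumberCurve n).baseChange K).selmerCorank 2 = 1 →
        ∀ (w : HeightOneSpectrum (𝓞 K)), ((2 : ℕ) : 𝓞 K) ∈ w.asIdeal →
          Finite ↥(((congruentNumberCurve n).baseChange K).selmerGroupPInfty 2 ⊓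
            selmerLocalKerPrimaryTorsion ((congruentNumberCurve n).baseChange K) (w.adicCompletion K) 2) :=
  ⟨fun hA _ hn K _ _ hK hH2 hcK w hw ↦ twoLocNonDegeneracy_of_cruxA hA hn K hK hH2 hcK w hw,
    fun hres ↦ cruxA_of_res_of_bdpExistsValueUpTo hpar hmod hHL hKato hHP hres hEV hWan⟩

/-- **THE BDP ROAD'S KERNEL CENSUS in the folded ♯ currency: the rung-S2 leaf
`rankOne_twoConverse_congruentNumber` ⟸ {(res) at `2`, (LB-exist∧bdp♯)∃, (LB-wan♯)} + the six refereed facts —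
and NOTHING else** (no ∀-tuple (LB-bdp♯), no character supply, no textbook hypothesis): the route's Assembly
(`CongruentShaFreeCutAssembly.assembly_holds`, item 19081, closed) applied to
`cruxA_of_res_of_bdpExistsValueUpTo` and `cruxB_of_bdpExistsValueUpTo`. Research content of the whole road =
ONE Selmer-only statement at the additive prime `2` + ONE construction-with-value + ONE main-conjecture
divisibility (both up to nonzero constants). CONDITIONAL; neither the congruent number problem nor any case
of BSD is touched. [cite: GrossZagier1986, Thm. I.6.3 with V.§2]
[cite: CastellaGrossiLeeSkinner2022, §5.2 (proof of Thm. 5.2.1)] [cite: Skinner2020, Thm. B (shape)] -/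
theorem leaf_of_res_of_bdpExistsValueUpTo
    (hpar : ∀ (W : WeierstrassCurve ℚ) [W.IsElliptic] (p : ℕ) [Fact p.Prime], p_parity W p)
    (hmod : ModularForms.exists_isNewformOf) (hHL : HoffsteinLuo1997_exists_twist_L_one_ne_zero)
    (hKato : ∀ (W : WeierstrassCurve ℚ) [W.IsElliptic] (p : ℕ) [Fact p.Prime],
      kato_finite_of_L_one_ne_zero W p)
    (hHP : ∀ (W : WeierstrassCurve ℚ) (K : Type) [Field K] [NumberField K],
      exists_isHeegnerPoint W K)
    (hGZ : ∀ (W : WeierstrassCurve ℚ) (N : ℕ) [NeZero N] (K : Type) [Field K] [NumberField K],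
      analyticRankEK_eq_one_iff_heegner_nonTorsion W N K)
    (hres : ∀ ⦃n : ℕ⦄, Squarefree n → ∀ (K : Type) [Field K] [NumberField K],
      IsImaginaryQuadratic K → SatisfiesHeegnerHypothesis 2 K →
        ((congruentNumberCurve n).baseChange K).selmerCorank 2 = 1 →
      ∀ (w : HeightOneSpectrum (𝓞 K)), ((2 : ℕ) : 𝓞 K) ∈ w.asIdeal →
        Finite ↥(((congruentNumberCurve n).baseChange K).selmerGroupPInfty 2 ⊓
          selmerLocalKerPrimaryTorsion ((congruentNumberCurve n).baseChange K) (w.adicCompletion K) 2))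
    (hEV : TwoAdicBDPElementExistsWithValueUpTo) (hWan : TwoAdicWanDivisibilityUpTo) :
    rankOne_twoConverse_congruentNumber :=
  CongruentShaFreeCutAssembly.assembly_holds
    (cruxA_of_res_of_bdpExistsValueUpTo hpar hmod hHL hKato hHP hres hEV hWan)
    (cruxB_of_bdpExistsValueUpTo hpar hmod hHL hKato hHP hGZ hEV hWan)

end Summit.BirchSwinnertonDyer.BirchSwinnertonDyer.Theorems.CongruentShaFreeCutTwoAdicBDPExistsValueUpTo

end
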